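import Literature.NumberTheory.EllipticCurves.SemistableModPImageMultiplicativeProofs
import Literature.NumberTheory.EllipticCurves.MatarNekovar2019.IrreducibleOverQuadraticFieldProofs
import Literature.NumberTheory.EllipticCurves.Rank1Residual.AnomalousDictionaryProofs
import Literature.NumberTheory.EllipticCurves.DivisionFieldRamificationDividesProofs
import Literature.NumberTheory.EllipticCurves.RootNumberTwistProofs
import HarnessLib

/-!
# Route `AdditiveBranchIMC` (rung K1), crux `MultLower` (stmt-BirchSwinnertonDyer-19359, line `tame_roads_mult`
# v20) and its (G-ord) twins 19357 / 19358: the TATE LINE of the multiplicative partner at `p`, in the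
# currency of the ordinary line, and the LINE CHARACTER `= χ̄_p` (cell-free)

Cell `bsd-addord`, LEAD seat `cruxlead-19357` (gen 7). THEOREMS ONLY (no definition, no named fact, no
`sorry`). Helper toward the registered stub `TameRoadsMult.stub_tameLocalVanishingM` (the (M) twin of
`ThreeFieldRoad.stub_tameLocalVanishingR0`): the ONE cell-specific input of the tame miracle
(LeadReport13 §3 / `Cruxes/GordTwoRankOne/PenNote2.md` §2 step (O)) is a line `ℤ v₀ ≤ V[p]` of the
PARTNER `V` (`E = V ⊗ χ_{p*}`) at a prime `𝔔 ∣ p` of `ℤ̄` such that every inertia element `τ ∈ I_𝔔`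
moves `V[p]` into `ℤ v₀`; on the (G-ord, `e = 2`) cell `V` is good ordinary at `p` and this is the
tree's `exists_ordinaryLine` (Serre 1972 §1.11 Prop. 11); on the (M) cell `V` is MULTIPLICATIVE at `p`
and the line is the Tate line `μ_p ↪ V[p]` (Serre 1972 §1.12, Cor. of Prop. 13), which the tree holds
in the form `exists_addSubgroup_card_le_of_hasMultiplicativeReductionAt` (a subgroup of order `≤ p`
receiving every `τ P − P`). This file re-keys the latter to EXACTLY the output shape of
`exists_ordinaryLine` (clauses 1–2), so that one assembly serves both cells, and records the cell-free
consequence of `det ρ̄_{E,p} = χ̄_p`: the inertia group acts on the line through `χ̄_p`.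

* `exists_line_of_hasMultiplicativeReductionAtPrime` — `V/ℚ` elliptic, `p` odd, `V` multiplicative
  at `p`, `v` the place of `ℚ` at `p`, `𝔔 ∈ v.primesAbove`: there is `v₀ ≠ 0` in `V[p]` with
  `τ x − x ∈ ℤ v₀` for all `τ ∈ I_𝔔`, `x ∈ V[p]`.
* `smul_eq_of_line` — for ANY `V/ℚ` elliptic and `v₀ ≠ 0` in `V[p]` with `τ x − x ∈ ℤ v₀` for all
  `x`: `τ v₀ = a v₀` for every integer `a` lifting `χ̄_p(τ)` (`det = χ̄_p` in the basis `(v₀, Q)`,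
  `modPCyclotomicCharacter_eq_det_of_basis`).

References: J.-P. Serre, Invent. Math. 15 (1972) §1.11 Prop. 11, §1.12 Prop. 13 and Cor.;
J. H. Silverman, *AEC* (2009) III.6.4, III.8 (Weil pairing: `det = χ̄_p`).
-/

set_option linter.dupNamespace false

noncomputable section

open scoped Classical

open NumberField IsDedekindDomain Field WeierstrassCurve Rat.HeightOneSpectrum
  Literature.NumberTheory.EllipticCurves Literature.NumberTheory.GaloisRepresentations

namespace Summit.BirchSwinnertonDyer.BirchSwinnertonDyer.Theorems.TameMultiplicativeLine

variable (W : WeierstrassCurve ℚ) [W.IsElliptic] {p : ℕ} [hp : Fact p.Prime]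

/-- **The Tate line in the currency of the ordinary line** (Serre 1972 §1.12, Cor. of Prop. 13): for
`V/ℚ` elliptic with MULTIPLICATIVE reduction at an odd prime `p`, `v` the place of `ℚ` at `p` and
`𝔔 ∣ v` a prime of `ℤ̄`, there is `v₀ ≠ 0` in `V[p]` such that `τ x − x ∈ ℤ v₀` for every
`τ ∈ I_𝔔` and every `x ∈ V[p]` (the subgroup of order `≤ p` of
`exists_addSubgroup_card_le_of_hasMultiplicativeReductionAt` is `0` or a line; in the first case any
`v₀ ≠ 0` serves). [cite: Serre1972, §1.12, Prop. 13 and Cor.] -/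
theorem exists_line_of_hasMultiplicativeReductionAtPrime (hp2 : p ≠ 2)
    (hmult : W.HasMultiplicativeReductionAtPrime p) {v : HeightOneSpectrum (𝓞 ℚ)}
    (hv : (primesEquiv v : ℕ) = p) {𝔔 : Ideal (absIntegers (𝓞 ℚ) ℚ)} (h𝔔 : 𝔔 ∈ v.primesAbove) :
    ∃ v₀ : geomTorsion W (p : ℤ), v₀ ≠ 0 ∧
      ∀ τ ∈ 𝔔.inertia (absoluteGaloisGroup ℚ), ∀ x : geomTorsion W (p : ℤ),
        ∃ n : ℤ, τ • x - x = n • v₀ := by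
  have hpr : p.Prime := hp.out
  have hpv : (p : 𝓞 ℚ) ∈ v.asIdeal :=
    Rank1Residual.natCast_mem_asIdeal_of_primesEquiv_eq hv
  -- multiplicative reduction at the place `v`
  have hmultv : W.HasMultiplicativeReductionAt v := by
    have hmult_v : haveI := Fact.mk (primesEquiv v).2;
        W.HasMultiplicativeReductionAtPrime (primesEquiv v) := by
      have key : ∀ (q : ℕ) (hq : Fact q.Prime), q = p →
          @WeierstrassCurve.HasMultiplicativeReductionAtPrime W q hq := by
        rintro q hq rfl; exact hmult
      exact key _ _ hv
    exact (hasMultiplicativeReductionAtPrime_iff_hasMultiplicativeReductionAt_ringOfIntegers W v).mp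
      hmult_v
  obtain ⟨X, hXcard, hX⟩ :=
    W.exists_addSubgroup_card_le_of_hasMultiplicativeReductionAt hp2 hpv hmultv h𝔔
  -- `#V[p] = p²`, so `V[p]` has a non-zero element
  have hcardT : Nat.card (geomTorsion W (p : ℤ)) = p ^ 2 := W.natCard_geomTorsion_prime_eq_sq hpr
  haveI : Finite (geomTorsion W (p : ℤ)) :=
    Nat.finite_of_card_ne_zero (by rw [hcardT]; exact pow_ne_zero 2 hpr.ne_zero)
  -- every element of `V[p]` is killed by `p`
  have hkill : ∀ y : geomTorsion W (p : ℤ), (p : ℤ) • y = 0 := fun y ↦ by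
    have hy : p • (y : geomPoints W) = 0 := AddSubgroup.torsionBy.nsmul_iff.mp y.2
    rw [natCast_zsmul]
    exact Subtype.ext (by rw [AddSubmonoidClass.coe_nsmul, ZeroMemClass.coe_zero]; exact hy)
  -- the order of a non-zero element is `p`
  have horder : ∀ y : geomTorsion W (p : ℤ), y ≠ 0 → addOrderOf y = p := fun y hy ↦ by
    refine addOrderOf_eq_prime ?_ hy
    have := hkill y
    rwa [natCast_zsmul] at this
  by_cases hbot : ∀ y ∈ X, y = 0
  · -- `X = 0`: inertia acts trivially; any non-zero `v₀` serves
    have hnt : Nontrivial (geomTorsion W (p : ℤ)) := by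
      rw [← Finite.one_lt_card_iff_nontrivial, hcardT]
      exact Nat.one_lt_pow two_ne_zero hpr.one_lt
    obtain ⟨v₀, hv₀⟩ := exists_ne (0 : geomTorsion W (p : ℤ))
    refine ⟨v₀, hv₀, fun τ hτ x ↦ ⟨0, ?_⟩⟩
    rw [zero_smul]
    exact hbot _ (hX τ hτ x)
  · -- `X` is a line `ℤ v₀`
    push Not at hbot
    obtain ⟨v₀, hv₀X, hv₀⟩ := hbot
    have hzcard : Nat.card (AddSubgroup.zmultiples v₀) = p := by
      rw [Nat.card_zmultiples, horder v₀ hv₀]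
    haveI : Finite X := inferInstance
    have hle : AddSubgroup.zmultiples v₀ ≤ X := (AddSubgroup.zmultiples_le_of_mem hv₀X)
    have heq : AddSubgroup.zmultiples v₀ = X :=
      AddSubgroup.eq_of_le_of_card_ge hle (by rw [hzcard]; exact hXcard)
    refine ⟨v₀, hv₀, fun τ hτ x ↦ ?_⟩
    have hmem : τ • x - x ∈ AddSubgroup.zmultiples v₀ := by rw [heq]; exact hX τ hτ x
    obtain ⟨n, hn⟩ := AddSubgroup.mem_zmultiples_iff.mp hmem
    exact ⟨n, hn.symm⟩

/-- **The inertia group acts on the line through `χ̄_p`** (cell-free: ANY `V/ℚ` elliptic, any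
`σ ∈ Γ_ℚ`). If `v₀ ≠ 0` in `V[p]` and `σ x − x ∈ ℤ v₀` for every `x ∈ V[p]`, then
`σ v₀ = a v₀` for every integer `a` with `a ≡ χ̄_p(σ) (mod p)`: in a basis `(v₀, Q)` one has
`σ v₀ = a′ v₀`, `σ Q = b v₀ + Q`, and `det ρ̄(σ) = a′ = χ̄_p(σ)` (`modPCyclotomicCharacter_eq_det_of_basis`).
[cite: Serre1972, §1.11 («le déterminant de ρ̄ est χ̄»); §1.12 Cor.] -/
theorem smul_eq_of_line {v₀ : geomTorsion W (p : ℤ)} (hv₀ : v₀ ≠ 0) {σ : absoluteGaloisGroup ℚ}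
    (hline : ∀ x : geomTorsion W (p : ℤ), ∃ n : ℤ, σ • x - x = n • v₀) {a : ℤ}
    (ha : ((a : ℤ) : ZMod p) = ((modPCyclotomicCharacterZMod ℚ p σ : (ZMod p)ˣ) : ZMod p)) :
    σ • v₀ = a • v₀ := by
  have hpr : p.Prime := hp.out
  haveI : NeZero (p : ℚ) := ⟨by exact_mod_cast hpr.ne_zero⟩
  -- cardinalities
  have hcardT : Nat.card (geomTorsion W (p : ℤ)) = p ^ 2 := W.natCard_geomTorsion_prime_eq_sq hpr
  haveI : Finite (geomTorsion W (p : ℤ)) :=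
    Nat.finite_of_card_ne_zero (by rw [hcardT]; exact pow_ne_zero 2 hpr.ne_zero)
  have hkill : ∀ y : geomTorsion W (p : ℤ), (p : ℤ) • y = 0 := fun y ↦ by
    have hy : p • (y : geomPoints W) = 0 := AddSubgroup.torsionBy.nsmul_iff.mp y.2
    rw [natCast_zsmul]
    exact Subtype.ext (by rw [AddSubmonoidClass.coe_nsmul, ZeroMemClass.coe_zero]; exact hy)
  have horder : addOrderOf v₀ = p := by
    refine addOrderOf_eq_prime ?_ hv₀
    have := hkill v₀
    rwa [natCast_zsmul] at this
  -- a second basis vector `Q ∉ ℤ v₀`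
  have hzcard : Nat.card (AddSubgroup.zmultiples v₀) = p := by
    rw [Nat.card_zmultiples, horder]
  obtain ⟨Q, hQ⟩ : ∃ Q : geomTorsion W (p : ℤ), Q ∉ AddSubgroup.zmultiples v₀ := by
    by_contra h
    push Not at h
    have htop : AddSubgroup.zmultiples v₀ = ⊤ := by
      rw [eq_top_iff]; exact fun Q _ ↦ h Q
    have hc : Nat.card (AddSubgroup.zmultiples v₀) = p ^ 2 := by
      rw [htop, AddSubgroup.card_top, hcardT]
    rw [hzcard] at hc
    have : p < p ^ 2 := by
      calc p = p ^ 1 := (pow_one p).symm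
        _ < p ^ 2 := Nat.pow_lt_pow_right hpr.one_lt (by norm_num)
    exact this.ne hc
  -- the matrix of `σ` in the basis `(v₀, Q)`
  obtain ⟨a', ha'⟩ := hline v₀
  obtain ⟨b, hb⟩ := hline Q
  have h₀ : σ • v₀ = (a' + 1) • v₀ + (0 : ℤ) • Q := by
    rw [zero_smul, add_zero, add_smul, one_smul, ← ha', sub_add_cancel]
  have h₁ : σ • Q = b • v₀ + (1 : ℤ) • Q := by
    rw [one_smul, ← hb, sub_add_cancel]
  have hdet := MatarNekovar2019.modPCyclotomicCharacter_eq_det_of_basis W p hv₀ hQ h₀ h₁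
  -- `χ̄_p(σ) = a' + 1`, hence `a ≡ a' + 1 (mod p)`
  have hcong : ((a : ℤ) : ZMod p) = (((a' + 1 : ℤ)) : ZMod p) := by
    rw [ha, hdet]; push_cast; ring
  rw [ZMod.intCast_eq_intCast_iff] at hcong
  -- `a • v₀ = (a'+1) • v₀` since `p • v₀ = 0`
  have hmod : a • v₀ = (a' + 1) • v₀ := by
    obtain ⟨k, hk⟩ := (Int.modEq_iff_dvd.mp hcong.symm)
    have : a = (a' + 1) + (p : ℤ) * k := by linarith
    rw [this, add_smul, mul_smul, hkill, add_zero]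
  rw [hmod, h₀, zero_smul, add_zero]

end Summit.BirchSwinnertonDyer.BirchSwinnertonDyer.Theorems.TameMultiplicativeLine

end
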